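import Mathlib
import HarnessLib.Audit
import Summits.PneNP.PneNP.Theorems.PstarGateNodesX
import Summits.PneNP.PneNP.Theorems.PstarChordBridgeFlat

/-!
# One GATED chord, CASE P with units: the TOUCH lemma for private tree edges and the read criteria (E2 node N2X; prover-1 g21)

FRONTIER range-avoidance ladder, rung F-N3 (`stmt-PneNP-19007`), cell `pnp-ideate` (`PstarGateNodesX.GateCasePUnitsX`); restricted-model proof
complexity — nothing here bears on `P` versus `NP`.

Instance-level bookkeeping for the last E2 node.  A tree edge `π` of the core whose AND pair `{α, α'}` is held by no other output of the core
(PRIVATE within `J₀`) can be repaired at the (M0) witness of `J₀ − π` by overwriting its AND pair — unless one of the two G-constraints reads `α`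
or `α'` directly (a linear read or a pendant gate):

* `touch` — **(T3) + (M0) at a private tree edge ⟹ `α` or `α'` lies in `C₁ ∪ C₂` or in the AND pair of a gate of `G₁ ∪ G₂`**
  (`eval_update_and_pair`, `eval_update_of_not_mem`, `gval_update_of_forall_ne`); `touch_of_gateHyp` — the same for one-gate data, where
  the gates other than `g₀` are private-free (`mem_freeMon_of_ne`, `mem_freeMon_of_mem_G₂`);
* the READ CRITERIA turning the model's constraint forms back into instance reads: `free_single_add_zero` / `qDir_single_add_zero` (the linear
  coefficient of a free variable `v` is `q_m(e_v) + q_m(0)`), `not_mem_C_of_qDir` (so `q_m(e_v) = q_m(0)` means `v` is no linear read), and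
  `freeMon_avoid_of_polar_zero` (if the polar form `polar T + polar (freeMon G)` vanishes at `(e_w, e_v)` for all `w`, no private-free gate of
  `G` contains `v`; simple overlaps, pendants off the core).
-/

set_option linter.dupNamespace false -- `Summit.PneNP.PneNP.…`: summit = sub-problem name (D-0017 single-conjunct layout)

open Finset Literature.Computability.Complexity
open Summit.PneNP.PneNP.Theorems.PstarFibrePolys (bit)
open Summit.PneNP.PneNP.Theorems.PstarTyped (Typed)
open Summit.PneNP.PneNP.Theorems.PstarSALevel (varSet)
open Summit.PneNP.PneNP.Theorems.PstarGapPeeling (eval_update_of_not_mem eval_update_and_pair)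
open Summit.PneNP.PneNP.Theorems.PstarCentreFree (vars_mem_varSet)
open Summit.PneNP.PneNP.Theorems.PstarXCore (xverts)
open Summit.PneNP.PneNP.Theorems.PstarGapOneAll (gval)
open Summit.PneNP.PneNP.Theorems.PstarGConstraint (gval_update_of_forall_ne)
open Summit.PneNP.PneNP.Theorems.PstarProductRank (qform polar)
open Summit.PneNP.PneNP.Theorems.PstarPathRank (AndAdj polar_basis and_ne)
open Summit.PneNP.PneNP.Theorems.PstarReadSumset (V2)
open Summit.PneNP.PneNP.Theorems.PstarChordBridgeTools (privs coef free not_mem_privs_of_mem_sdiff not_mem_xverts_of_two_le)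
open Summit.PneNP.PneNP.Theorems.PstarChordBridge (BridgeData Solution)
open Summit.PneNP.PneNP.Theorems.PstarChordBridgeForcing (freeMon free_eq)
open Summit.PneNP.PneNP.Theorems.PstarChordBridgeBasis (qDir polarDir)
open Summit.PneNP.PneNP.Theorems.PstarChordBridgeCorner (andAdj_iff_mem)
open Summit.PneNP.PneNP.Theorems.PstarGateBridge (GateHyp)
open Summit.PneNP.PneNP.Theorems.PstarChordBridgeFlat (qform_zero qform_single andAdj_comm)

namespace Summit.PneNP.PneNP.Theorems.PstarGateCasePUnitsTouch

variable {n m : ℕ}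

/-! ## The touch lemma -/

/-- **TOUCH.**  (T3), (M0) at a tree edge `π` private within `J₀`, and NO direct read of its AND pair by either constraint — contradiction:
overwrite the AND pair of `π` at the (M0) witness so that `π` holds; nothing else changes. -/
theorem touch (I : LocalMap 4 n m) (hI : I.IsPure xorAndPred) {B : BridgeData n m} (hT3 : ¬ ∃ z, Solution I B B.J₀ z) {π : Fin m}
    (hM0 : ∃ z, Solution I B (B.J₀.erase π) z) (hpriv : ∀ j ∈ B.J₀, j ≠ π → I.vars π 2 ∉ varSet I j ∧ I.vars π 3 ∉ varSet I j)
    (hC₁ : I.vars π 2 ∉ B.C₁ ∧ I.vars π 3 ∉ B.C₁) (hC₂ : I.vars π 2 ∉ B.C₂ ∧ I.vars π 3 ∉ B.C₂)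
    (hG₁ : ∀ g ∈ B.G₁, I.vars g 2 ≠ I.vars π 2 ∧ I.vars g 3 ≠ I.vars π 2 ∧ I.vars g 2 ≠ I.vars π 3 ∧ I.vars g 3 ≠ I.vars π 3)
    (hG₂ : ∀ g ∈ B.G₂, I.vars g 2 ≠ I.vars π 2 ∧ I.vars g 3 ≠ I.vars π 2 ∧ I.vars g 2 ≠ I.vars π 3 ∧ I.vars g 3 ≠ I.vars π 3) : False := by
  obtain ⟨z, hzJ, hz₁, hz₂⟩ := hM0
  set c : Bool := xor (xor (z (I.vars π 0)) (z (I.vars π 1))) (B.y π) with hc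
  set z' : Fin n → Bool := Function.update (Function.update z (I.vars π 2) c) (I.vars π 3) c with hz'
  apply hT3
  refine ⟨z', fun j hj => ?_, ?_, ?_⟩
  · by_cases hjπ : j = π
    · subst hjπ
      rw [hz', eval_update_and_pair I hI, hc]
      cases z (I.vars j 0) <;> cases z (I.vars j 1) <;> cases B.y j <;> rfl
    · obtain ⟨h2, h3⟩ := hpriv j hj hjπ
      rw [hz', eval_update_of_not_mem I j _ h3, eval_update_of_not_mem I j _ h2]
      exact hzJ j (mem_erase.2 ⟨hjπ, hj⟩)
  · rw [hz', gval_update_of_forall_ne I _ hC₁.2 (fun g hg => ⟨(hG₁ g hg).2.2.1, (hG₁ g hg).2.2.2⟩),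
      gval_update_of_forall_ne I _ hC₁.1 (fun g hg => ⟨(hG₁ g hg).1, (hG₁ g hg).2.1⟩)]
    exact hz₁
  · rw [hz', gval_update_of_forall_ne I _ hC₂.2 (fun g hg => ⟨(hG₂ g hg).2.2.1, (hG₂ g hg).2.2.2⟩),
      gval_update_of_forall_ne I _ hC₂.1 (fun g hg => ⟨(hG₂ g hg).1, (hG₂ g hg).2.1⟩)]
    exact hz₂

/-! ## One-gate data: the gates other than `g₀` are private-free -/

/-- Under the gate hypotheses every gate of `G₁` other than `g₀` is private-free. -/
theorem mem_freeMon_of_ne (I : LocalMap 4 n m) {B : BridgeData n m} {e g₀ : Fin m} (hG : GateHyp I B e)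
    (hG₁p : ∀ g ∈ B.G₁.erase g₀, I.vars g 2 ≠ I.vars e 2 ∧ I.vars g 3 ≠ I.vars e 2) {g : Fin m} (hg : g ∈ B.G₁) (hne : g ≠ g₀) :
    g ∈ freeMon I B.N B.G₁ := by
  obtain ⟨-, hun, -⟩ := hG
  refine mem_filter.2 ⟨hg, ?_⟩
  have hp := hG₁p g (mem_erase.2 ⟨hne, hg⟩)
  rintro (h | h)
  · by_cases hv : I.vars g 2 = I.vars e 2
    · exact hp.1 hv
    · exact ((hun _ h hv).1 g hg).1 rfl
  · by_cases hv : I.vars g 3 = I.vars e 2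
    · exact hp.2 hv
    · exact ((hun _ h hv).1 g hg).2 rfl

/-- Under the gate hypotheses every gate of `G₂` is private-free. -/
theorem mem_freeMon_of_mem_G₂ (I : LocalMap 4 n m) {B : BridgeData n m} {e : Fin m} (hG : GateHyp I B e) {g : Fin m} (hg : g ∈ B.G₂) :
    g ∈ freeMon I B.N B.G₂ := by
  obtain ⟨-, hun, hG₂p, -⟩ := hG
  refine mem_filter.2 ⟨hg, ?_⟩
  rintro (h | h)
  · by_cases hv : I.vars g 2 = I.vars e 2
    · exact (hG₂p g hg).1 hv
    · exact ((hun _ h hv).2 g hg).1 rfl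
  · by_cases hv : I.vars g 3 = I.vars e 2
    · exact (hG₂p g hg).2 hv
    · exact ((hun _ h hv).2 g hg).2 rfl

/-- **TOUCH for one-gate data.**  A tree edge private within `J₀ ∪ {g₀}` whose AND pair is read linearly by neither constraint and lies in no
private-free gate contradicts (T3) + (M0). -/
theorem touch_of_gateHyp (I : LocalMap 4 n m) (hI : I.IsPure xorAndPred) {B : BridgeData n m} {e g₀ : Fin m} (hG : GateHyp I B e)
    (hg₀J : g₀ ∉ B.J₀) (hG₁p : ∀ g ∈ B.G₁.erase g₀, I.vars g 2 ≠ I.vars e 2 ∧ I.vars g 3 ≠ I.vars e 2)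
    (hT3 : ¬ ∃ z, Solution I B B.J₀ z) {π : Fin m} (hπ : π ∈ B.J₀) (hM0 : ∃ z, Solution I B (B.J₀.erase π) z)
    (hpriv : ∀ j ∈ insert g₀ B.J₀, j ≠ π → I.vars π 2 ∉ varSet I j ∧ I.vars π 3 ∉ varSet I j)
    (hC : I.vars π 2 ∉ B.C₁ ∧ I.vars π 3 ∉ B.C₁ ∧ I.vars π 2 ∉ B.C₂ ∧ I.vars π 3 ∉ B.C₂)
    (hf₁ : ∀ g ∈ freeMon I B.N B.G₁, I.vars g 2 ≠ I.vars π 2 ∧ I.vars g 3 ≠ I.vars π 2 ∧ I.vars g 2 ≠ I.vars π 3 ∧ I.vars g 3 ≠ I.vars π 3)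
    (hf₂ : ∀ g ∈ freeMon I B.N B.G₂, I.vars g 2 ≠ I.vars π 2 ∧ I.vars g 3 ≠ I.vars π 2 ∧ I.vars g 2 ≠ I.vars π 3 ∧ I.vars g 3 ≠ I.vars π 3) :
    False := by
  refine touch I hI hT3 hM0 (fun j hj hne => hpriv j (mem_insert_of_mem hj) hne) ⟨hC.1, hC.2.1⟩ ⟨hC.2.2.1, hC.2.2.2⟩ ?_ ?_
  · intro g hg
    by_cases hgg : g = g₀
    · subst hgg
      obtain ⟨h2, h3⟩ := hpriv g (mem_insert_self _ _) (fun h => hg₀J (h ▸ hπ))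
      exact ⟨fun h => h2 (h ▸ vars_mem_varSet I g 2), fun h => h2 (h ▸ vars_mem_varSet I g 3),
        fun h => h3 (h ▸ vars_mem_varSet I g 2), fun h => h3 (h ▸ vars_mem_varSet I g 3)⟩
    · exact hf₁ g (mem_freeMon_of_ne I hG hG₁p hg hgg)
  · exact fun g hg => hf₂ g (mem_freeMon_of_mem_G₂ I hG hg)

/-! ## Read criteria -/

/-- **The linear coefficient of a variable in a state-free part**: `free(e_v) + free(0) = [v ∈ C, v no XOR vertex, v no private]`. -/
theorem free_single_add_zero (I : LocalMap 4 n m) (hI : I.IsPure xorAndPred) (y : Fin m → Bool) (F N T : Finset (Fin m)) (C : Finset (Fin n))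
    (G : Finset (Fin m)) (v : Fin n) :
    free I y F N T C G (Pi.single v 1) + free I y F N T C G 0 = if (v ∈ C ∧ v ∉ xverts I F ∧ v ∉ privs I N) then 1 else 0 := by
  classical
  rw [free_eq, free_eq, qform_single I hI, qform_single I hI, qform_zero, qform_zero]
  have hs : ∑ w ∈ C.filter (fun w => w ∉ xverts I F ∧ w ∉ privs I N), (Pi.single v (1 : ZMod 2) : Fin n → ZMod 2) w =
      if (v ∈ C ∧ v ∉ xverts I F ∧ v ∉ privs I N) then 1 else 0 := by
    simp only [Pi.single_apply, sum_ite_eq', mem_filter]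
  have h0 : ∑ w ∈ C.filter (fun w => w ∉ xverts I F ∧ w ∉ privs I N), (0 : Fin n → ZMod 2) w = 0 := by
    simp only [Pi.zero_apply, sum_const_zero]
  rw [hs, h0]
  generalize ∑ j ∈ T, bit (y j) = s
  generalize (if (v ∈ C ∧ v ∉ xverts I F ∧ v ∉ privs I N) then (1 : ZMod 2) else 0) = a
  revert a s; decide

/-- **The linear coefficient of `v` in `q_m`**: `q_m(e_v) + q_m(0) = m₂·[v ∈ C₁ free] + m₁·[v ∈ C₂ free]`. -/
theorem qDir_single_add_zero (I : LocalMap 4 n m) (hI : I.IsPure xorAndPred) (B : BridgeData n m) (mv : V2) (v : Fin n) :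
    qDir I B mv (Pi.single v 1) + qDir I B mv 0 =
      mv.2 * (if (v ∈ B.C₁ ∧ v ∉ xverts I (B.J₀ \ B.N) ∧ v ∉ privs I B.N) then 1 else 0) +
      mv.1 * (if (v ∈ B.C₂ ∧ v ∉ xverts I (B.J₀ \ B.N) ∧ v ∉ privs I B.N) then 1 else 0) := by
  unfold PstarChordBridgeBasis.qDir
  rw [← free_single_add_zero I hI B.y (B.J₀ \ B.N) B.N B.T₁ B.C₁ B.G₁ v, ← free_single_add_zero I hI B.y (B.J₀ \ B.N) B.N B.T₂ B.C₂ B.G₂ v]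
  generalize free I B.y (B.J₀ \ B.N) B.N B.T₁ B.C₁ B.G₁ (Pi.single v 1) = a
  generalize free I B.y (B.J₀ \ B.N) B.N B.T₁ B.C₁ B.G₁ 0 = a₀
  generalize free I B.y (B.J₀ \ B.N) B.N B.T₂ B.C₂ B.G₂ (Pi.single v 1) = c
  generalize free I B.y (B.J₀ \ B.N) B.N B.T₂ B.C₂ B.G₂ 0 = c₀
  generalize bit B.b₁ = t₁; generalize bit B.b₂ = t₂
  obtain ⟨m₁, m₂⟩ := mv
  simp only
  revert a a₀ c c₀ t₁ t₂ m₁ m₂; decide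

/-- **No linear read.**  For an AND variable `v = vars π s` (`s ∈ {2,3}`) of a tree edge `π`: if `q_{(0,1)}(e_v) = q_{(0,1)}(0)` then `v ∉ C₁`,
and if `q_{(1,0)}(e_v) = q_{(1,0)}(0)` then `v ∉ C₂`. -/
theorem not_mem_C_of_qDir (I : LocalMap 4 n m) (hI : I.IsPure xorAndPred) (hT : Typed I) {B : BridgeData n m} (hW : B.WF I) {π : Fin m}
    (hπ : π ∈ B.J₀ \ B.N) {s : Fin 4} (hs : 2 ≤ s.val) :
    (qDir I B (0, 1) (Pi.single (I.vars π s) 1) = qDir I B (0, 1) 0 → I.vars π s ∉ B.C₁) ∧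
    (qDir I B (1, 0) (Pi.single (I.vars π s) 1) = qDir I B (1, 0) 0 → I.vars π s ∉ B.C₂) := by
  have hx : I.vars π s ∉ xverts I (B.J₀ \ B.N) := not_mem_xverts_of_two_le I hT _ π hs
  have hp : I.vars π s ∉ privs I B.N := not_mem_privs_of_mem_sdiff I hW.hN hW.hchord hπ s
  have e2 : ∀ a b : ZMod 2, a = b → a + b = 0 := by decide
  constructor
  · intro h hC
    have h1 := qDir_single_add_zero I hI B (0, 1) (I.vars π s)
    rw [e2 _ _ h, if_pos ⟨hC, hx, hp⟩] at h1
    revert h1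
    split_ifs <;> decide
  · intro h hC
    have h1 := qDir_single_add_zero I hI B (1, 0) (I.vars π s)
    rw [e2 _ _ h] at h1
    rw [if_pos (show I.vars π s ∈ B.C₂ ∧ I.vars π s ∉ xverts I (B.J₀ \ B.N) ∧ I.vars π s ∉ privs I B.N from ⟨hC, hx, hp⟩)] at h1
    revert h1
    split_ifs <;> decide

/-- **No pendant gate.**  If the form `polar T + polar (freeMon G)` (`T` inside the core, `G` off the core) vanishes at `(e_w, e_v)` for every
`w`, then no private-free gate of `G` has `v` in its AND pair. -/
theorem freeMon_avoid_of_polar_zero (I : LocalMap 4 n m) (hI : I.IsPure xorAndPred) (hS : PstarSALevel.SimpleOverlap I) {J₀ N T G : Finset (Fin m)}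
    (hTJ : T ⊆ J₀) (hGJ : Disjoint G J₀) {v : Fin n}
    (h : ∀ w, ((polar T (fun j => I.vars j 2) (fun j => I.vars j 3) + polar (freeMon I N G) (fun j => I.vars j 2) (fun j => I.vars j 3) :
      LinearMap.BilinForm (ZMod 2) (Fin n → ZMod 2)) (Pi.single w 1)) (Pi.single v 1) = 0) :
    ∀ g ∈ freeMon I N G, I.vars g 2 ≠ v ∧ I.vars g 3 ≠ v := by
  classical
  intro g hg
  have hgG : g ∈ G := (mem_filter.1 hg).1
  have hgT : g ∉ T := fun h' => Finset.disjoint_left.1 hGJ hgG (hTJ h')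
  have key : ∀ c d : Fin n, ((I.vars g 2 = c ∧ I.vars g 3 = d) ∨ (I.vars g 2 = d ∧ I.vars g 3 = c)) →
      ((polar T (fun j => I.vars j 2) (fun j => I.vars j 3) + polar (freeMon I N G) (fun j => I.vars j 2) (fun j => I.vars j 3) :
        LinearMap.BilinForm (ZMod 2) (Fin n → ZMod 2)) (Pi.single c 1)) (Pi.single d 1) = 1 := by
    intro c d hcd
    have hT0 : ¬ AndAdj I T c d := by
      intro hA
      have hA' : AndAdj I T (I.vars g 2) (I.vars g 3) := by
        rcases hcd with ⟨rfl, rfl⟩ | ⟨rfl, rfl⟩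
        · exact hA
        · exact (andAdj_comm I T _ _).1 hA
      exact hgT ((andAdj_iff_mem I hI hS T g).1 hA')
    have hG1 : AndAdj I (freeMon I N G) c d := ⟨g, hg, hcd⟩
    rw [LinearMap.add_apply, LinearMap.add_apply, polar_basis I hI hS, polar_basis I hI hS, if_neg hT0, if_pos hG1, zero_add]
  refine ⟨fun h2 => ?_, fun h3 => ?_⟩
  · have := h (I.vars g 3)
    rw [key (I.vars g 3) v (Or.inr ⟨h2, rfl⟩)] at this
    exact one_ne_zero this
  · have := h (I.vars g 2)
    rw [key (I.vars g 2) v (Or.inl ⟨rfl, h3⟩)] at this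
    exact one_ne_zero this

/-- `polarDir` on basis vectors: join and private-free pendant adjacencies of the two constraints. -/
theorem polarDir_single (I : LocalMap 4 n m) (B : BridgeData n m) (mv : V2) (c d : Fin n) :
    polarDir I B mv (Pi.single c 1) (Pi.single d 1) =
      mv.2 * (((polar B.T₁ (fun j => I.vars j 2) (fun j => I.vars j 3) + polar (freeMon I B.N B.G₁) (fun j => I.vars j 2) (fun j => I.vars j 3) :
        LinearMap.BilinForm (ZMod 2) (Fin n → ZMod 2)) (Pi.single c 1)) (Pi.single d 1)) +
      mv.1 * (((polar B.T₂ (fun j => I.vars j 2) (fun j => I.vars j 3) + polar (freeMon I B.N B.G₂) (fun j => I.vars j 2) (fun j => I.vars j 3) :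
        LinearMap.BilinForm (ZMod 2) (Fin n → ZMod 2)) (Pi.single c 1)) (Pi.single d 1)) := by
  unfold PstarChordBridgeBasis.polarDir PstarChordBridgeForcing.freePolar
  rw [LinearMap.add_apply, LinearMap.add_apply, LinearMap.smul_apply, LinearMap.smul_apply, LinearMap.smul_apply, LinearMap.smul_apply,
    smul_eq_mul, smul_eq_mul]

/-- **No pendant gate, directional form.**  `polarDir (0,1) (e_w, e_v) = 0` for all `w` ⟹ no private-free gate of `G₁` contains `v`;
`polarDir (1,0) (e_w, e_v) = 0` for all `w` ⟹ none of `G₂`. -/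
theorem freeMon_avoid_of_polarDir_zero (I : LocalMap 4 n m) (hI : I.IsPure xorAndPred) (hS : PstarSALevel.SimpleOverlap I) {B : BridgeData n m}
    (hW : B.WF I) (hd₁ : Disjoint B.G₁ B.J₀) (hd₂ : Disjoint B.G₂ B.J₀) {v : Fin n} :
    ((∀ w, polarDir I B (0, 1) (Pi.single w 1) (Pi.single v 1) = 0) → ∀ g ∈ freeMon I B.N B.G₁, I.vars g 2 ≠ v ∧ I.vars g 3 ≠ v) ∧
    ((∀ w, polarDir I B (1, 0) (Pi.single w 1) (Pi.single v 1) = 0) → ∀ g ∈ freeMon I B.N B.G₂, I.vars g 2 ≠ v ∧ I.vars g 3 ≠ v) := by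
  constructor
  · intro h
    refine freeMon_avoid_of_polar_zero I hI hS (hW.hT₁.trans sdiff_subset) hd₁ fun w => ?_
    have hw := h w
    rw [polarDir_single] at hw
    simpa using hw
  · intro h
    refine freeMon_avoid_of_polar_zero I hI hS (hW.hT₂.trans sdiff_subset) hd₂ fun w => ?_
    have hw := h w
    rw [polarDir_single] at hw
    simpa using hw

end Summit.PneNP.PneNP.Theorems.PstarGateCasePUnitsTouch
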